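import Mathlib.Algebra.BigOperators.NatAntidiagonal
import Literature.NumberTheory.Transcendental.Dolbeault
import Literature.Algebra.Homology.FilteredComplexFinrank
import HarnessLib

/-!
# The de Rham complex of a complex manifold as a bigraded triple (Frölicher inequality, glue)

Companion to `Literature/Algebra/Homology/FilteredComplexFinrank` (the algebra of the Frölicher
inequality, fully proved) and to the named facts of
`Literature/AlgebraicGeometry/Motives/DeRhamComparison` (hodge.S18:
`finrank_complexDeRham_le_sum_hodgeNumber`, `bettiNumber_le_sum_hodgeNumber`), following
C. Voisin, *Hodge Theory and Complex Algebraic Geometry I* (2002), §8.3.3, proof of Thm. 8.28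
and Rem. 8.29, pp. 204–205, with §2.3.1 (Def. 2.27: `∂̄α`, `∂α` are the `(p,q+1)`- and
`(p+1,q)`-components of `dα`) and Prop. 8.25 (`E_1^{p,q} = H^q(K^{p,•}, ∂̄)`).

A `Literature.Algebra.Homology.BigradedTriple` on three consecutive degrees of the de Rham
complex of smooth complex-valued forms (`csmoothForms E M k`, differential `mextDeriv`, type
projections `α ↦ α^{p,k-p}` = `MForm.typeComponent`) is consumed here only through the
*equations* defining its maps, so that this file introduces no definitions. We prove:

* `exists_linearMap_typeComponent`, `exists_linearMap_mextDeriv`: `ℂ`-linear packaging of the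
  type projections and of `d` on smooth forms (existence form);
* `sum_range_typeComponent`, `typeComponent_mextDeriv_typeComponent_of_ne`: the axioms
  `∑_p π p = id` and "`d` of a pure type-`p` form has first degrees `p`, `p+1` only"
  (`d = ∂ + ∂̄`);
* `map_pureClosed_eq_dolbeaultClosedForms`,
  `nonempty_pureCohomology_equiv_dolbeaultCohomology_zero`,
  `nonempty_pureCohomology_equiv_dolbeaultCohomology_succ`: the `∂̄`-cohomology in pure type `p`
  of such a triple is the Dolbeault group `H^{p,q}_{∂̄}(M)` (`dolbeaultCohomology E M p q`);
* `finite_and_finrank_complexDeRham_le_of_bigradedTriple`: hence, by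
  `BigradedTriple.finite_and_finrank_cohomology_le_sum_of_equiv` and the identification of the
  middle cohomology with `H^k_dR(M; ℂ)` (`complexDeRhamCohomology E M k`), finiteness of
  `H^k_dR(M; ℂ)` and `dim_ℂ H^k_dR(M; ℂ) ≤ ∑_{p+q=k} h^{p,q}(M)` whenever the Dolbeault groups are
  finite-dimensional.

Everything is **conditional** (D-0014) on named facts of the preludes, threaded as hypotheses
where used: `inChart_mextDeriv` (chart-independence of `d`: `d² = 0`, smoothness of `dα`;
`ManifoldForms`), `mextDeriv_smul_complex`, `isSmoothForm_typeComponent`,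
`sum_antidiagonal_typeComponent`, `typeComponent_typeComponent`,
`isOfType_iff_typeComponent_eq_self` (`ComplexForms`: the pointwise `(p,q)`-decomposition),
`mextDeriv_eq_dolbeault_add_dolbeaultBar`, `IsOfType.dolbeault_eq`, `IsOfType.dolbeaultBar_eq`
(`Dolbeault`). The construction of the triples in each degree and the resulting reductions of the
hodge.S18 facts are in `DeRhamComparisonFrolicherProofs`. Degrees are kept syntactically aligned
(`p + q`, `p + q + 1`) so that the Dolbeault groups, which live over `MForm … (p + q)`, are
compared without transport.

Relation to `Literature/LinearAlgebra/Filtration/FroelicherInequality` (a hypothesis-light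
cardinal form of the same count, keyed on a map `ψₚ` from filtered cycles): the bigraded triple
used here derives that key hypothesis from the `d = ∂ + ∂̄` axioms; either algebra file can
serve a consumer.

## References

* A. Frölicher, *Relations between the cohomology groups of Dolbeault and topological
  invariants*, Proc. Nat. Acad. Sci. USA 41 (1955), 641–644 (`FrolicherPNAS1955`).
* C. Voisin, *Hodge Theory and Complex Algebraic Geometry I* (2002), §2.3.1 (Def. 2.27),
  Prop. 8.25, §8.3.3 (proof of Thm. 8.28, Rem. 8.29), pp. 85–86, 203–205 (`VoisinHodgeI2002`).
* R. O. Wells, *Differential Analysis on Complex Manifolds* (1980), Ch. II §1 (`WellsDACM1980`).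
-/

noncomputable section

open scoped Manifold ContDiff
open Module Finset
open Literature.Geometry.Kaehler Literature.NumberTheory.Transcendental Literature.Algebra.Homology

namespace Literature.AlgebraicGeometry.Motives

section FrolicherLemmas

variable {E : Type*} [NormedAddCommGroup E] [NormedSpace ℂ E]
  {M : Type*} [TopologicalSpace M] [ChartedSpace E M]

/-! ### Linear packaging of `typeComponent` and `d` on smooth complex forms -/

/-- The type projections `α ↦ α^{r,s}` as `ℂ`-linear endomorphisms of the smooth complex
`j`-forms (existence form; smoothness of `α^{r,s}` is the named fact
`isSmoothForm_typeComponent`). Voisin (2002), §2.3.1. [cite: VoisinHodgeI2002, §2.3.1] -/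
theorem exists_linearMap_typeComponent {j : ℕ}
    (hst : isSmoothForm_typeComponent (E := E) (M := M) (k := j)) :
    ∃ f : ℕ → ℕ → (↥(csmoothForms E M j) →ₗ[ℂ] ↥(csmoothForms E M j)),
      ∀ (r s : ℕ) (x : ↥(csmoothForms E M j)),
        (f r s x : MForm 𝓘(ℝ, E) M ℂ j) = (x : MForm 𝓘(ℝ, E) M ℂ j).typeComponent r s :=
  ⟨fun r s ↦
    { toFun := fun x ↦ ⟨(x : MForm 𝓘(ℝ, E) M ℂ j).typeComponent r s,
        (mem_csmoothForms_iff _).2 (hst r s ((mem_csmoothForms_iff _).1 x.2))⟩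
      map_add' := fun _ _ ↦ Subtype.ext (MForm.typeComponent_add r s _ _)
      map_smul' := fun c _ ↦ Subtype.ext (MForm.typeComponent_smul r s c _) },
    fun _ _ _ ↦ rfl⟩

/-- The exterior derivative as a `ℂ`-linear map from smooth complex `j`-forms to smooth complex
`(j+1)`-forms (existence form; `ℂ`-linearity and smoothness of `dα` are the named facts
`mextDeriv_smul_complex` and `inChart_mextDeriv`). Warner (1983), Thm. 2.20; Wells (1980),
Ch. II §1. [cite: WellsDACM1980, Ch. II §1] -/
theorem exists_linearMap_mextDeriv [IsManifold 𝓘(ℝ, E) ∞ M] {j : ℕ}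
    (hic : inChart_mextDeriv 𝓘(ℝ, E) M ℂ)
    (hsc : mextDeriv_smul_complex (E := E) (M := M) (k := j)) :
    ∃ d : ↥(csmoothForms E M j) →ₗ[ℂ] ↥(csmoothForms E M (j + 1)),
      ∀ x : ↥(csmoothForms E M j),
        (d x : MForm 𝓘(ℝ, E) M ℂ (j + 1)) = mextDeriv (x : MForm 𝓘(ℝ, E) M ℂ j) :=
  ⟨{ toFun := fun x ↦ ⟨mextDeriv (x : MForm 𝓘(ℝ, E) M ℂ j),
        (mem_csmoothForms_iff _).2 (isSmoothForm_mextDeriv hic ((mem_csmoothForms_iff _).1 x.2))⟩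
     map_add' := fun x y ↦
       Subtype.ext (mextDeriv_add ((mem_csmoothForms_iff _).1 x.2) ((mem_csmoothForms_iff _).1 y.2))
     map_smul' := fun c _ ↦ Subtype.ext (hsc c _) },
    fun _ ↦ rfl⟩

/-! ### The axioms of a bigraded triple for the de Rham complex -/

/-- Type decomposition of a `k`-form indexed by the first degree:
`∑_{p=0}^{k} α^{p,k-p} = α` (from the named fact `sum_antidiagonal_typeComponent`).
Voisin (2002), §2.3.1. [cite: VoisinHodgeI2002, §2.3.1] -/
theorem sum_range_typeComponent {k : ℕ}
    (hsum : sum_antidiagonal_typeComponent (E := E) (M := M) (k := k))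
    (α : MForm 𝓘(ℝ, E) M ℂ k) :
    ∑ p ∈ range (k + 1), α.typeComponent p (k - p) = α := by
  have h := Finset.Nat.sum_antidiagonal_eq_sum_range_succ (fun p q ↦ α.typeComponent p q) k
  rw [hsum α] at h
  exact h.symm

/-- **`d = ∂ + ∂̄` in components**: for a smooth `k`-form `α`, the exterior derivative of its
component `α^{p,k-p}` of first degree `p` has no component of first degree `r ∉ {p, p+1}`
(from the named facts `mextDeriv_eq_dolbeault_add_dolbeaultBar`, `IsOfType.dolbeault_eq`,
`IsOfType.dolbeaultBar_eq` and the pointwise type calculus). Voisin (2002), §2.3.3,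
Prop. 2.31 / Def. 2.33. [cite: VoisinHodgeI2002, §2.3.3] -/
theorem typeComponent_mextDeriv_typeComponent_of_ne [IsManifold 𝓘(ℂ, E) ω M]
    [IsManifold 𝓘(ℝ, E) ∞ M] {k : ℕ}
    (hst : isSmoothForm_typeComponent (E := E) (M := M) (k := k))
    (htt : ∀ {k : ℕ}, typeComponent_typeComponent (E := E) (M := M) (k := k))
    (hio : isOfType_iff_typeComponent_eq_self (E := E) (M := M) (k := k))
    (hdd : mextDeriv_eq_dolbeault_add_dolbeaultBar (E := E) (M := M) (k := k))
    (hdel : IsOfType.dolbeault_eq (E := E) (M := M) (k := k))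
    (hdelbar : IsOfType.dolbeaultBar_eq (E := E) (M := M) (k := k))
    {p r : ℕ} (hr : r ≠ p) (hr' : r ≠ p + 1) (s : ℕ) {α : MForm 𝓘(ℝ, E) M ℂ k}
    (hα : IsSmoothForm α) :
    (mextDeriv (α.typeComponent p (k - p))).typeComponent r s = 0 := by
  by_cases hp : p + (k - p) = k
  · have hβs : IsSmoothForm (α.typeComponent p (k - p)) := hst p (k - p) hα
    have hβt : IsOfType p (k - p) (α.typeComponent p (k - p)) :=
      (hio hp _).2 (by rw [htt, if_pos ⟨rfl, rfl⟩])
    have h1 : ¬(p + 1 = r ∧ k - p = s) := fun h ↦ hr' h.1.symm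
    have h2 : ¬(p = r ∧ k - p + 1 = s) := fun h ↦ hr h.1.symm
    rw [hdd hβs, hdel hβt, hdelbar hβt, MForm.typeComponent_add, htt, htt, if_neg h1, if_neg h2,
      add_zero]
  · rw [MForm.typeComponent_of_ne hp, mextDeriv_zero, MForm.typeComponent_zero]

/-! ### Identification of the pure-type `∂̄`-cohomology with the Dolbeault groups -/

/-- For a bigraded triple on `A^{p+q}(M; ℂ) → A^{p+q+1}(M; ℂ)` whose middle-degree projection of
index `p` is `α ↦ α^{p,q}`, whose upper-degree projection of index `p` is `β ↦ β^{p,q+1}` and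
whose differential is `d`, the `∂̄`-closed elements of pure type `p` are exactly the
`∂̄`-closed smooth `(p,q)`-forms `Z^{p,q}_{∂̄}(M)` (`∂̄α = (dα)^{p,q+1}` on `(p,q)`-forms).
Voisin (2002), §2.3.3 and Prop. 8.25. [cite: VoisinHodgeI2002, Prop. 8.25] -/
theorem map_pureClosed_eq_dolbeaultClosedForms {p q : ℕ} {A₀ : Type*} [AddCommGroup A₀]
    [Module ℂ A₀]
    (B : BigradedTriple ℂ A₀ ↥(csmoothForms E M (p + q)) ↥(csmoothForms E M (p + q + 1)))
    (hπ₁ : ∀ x, (B.π₁ p x : MForm 𝓘(ℝ, E) M ℂ (p + q)) =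
      (x : MForm 𝓘(ℝ, E) M ℂ (p + q)).typeComponent p q)
    (hπ₂ : ∀ y, (B.π₂ p y : MForm 𝓘(ℝ, E) M ℂ (p + q + 1)) =
      (y : MForm 𝓘(ℝ, E) M ℂ (p + q + 1)).typeComponent p (q + 1))
    (hd₁ : ∀ x, (B.d₁ x : MForm 𝓘(ℝ, E) M ℂ (p + q + 1)) =
      mextDeriv (x : MForm 𝓘(ℝ, E) M ℂ (p + q)))
    (hio : isOfType_iff_typeComponent_eq_self (E := E) (M := M) (k := p + q))
    (hdelbar : IsOfType.dolbeaultBar_eq (E := E) (M := M) (k := p + q)) :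
    (B.pureClosed p).map (csmoothForms E M (p + q)).subtype = dolbeaultClosedForms E M p q := by
  refine le_antisymm ?_ (Submodule.span_le.2 ?_)
  · rintro _ ⟨x, ⟨hx₁, hx₂⟩, rfl⟩
    have hxs : IsSmoothForm (x : MForm 𝓘(ℝ, E) M ℂ (p + q)) := (mem_csmoothForms_iff _).1 x.2
    have hxt : IsOfType p q (x : MForm 𝓘(ℝ, E) M ℂ (p + q)) :=
      (hio rfl _).2 (by rw [← hπ₁, hx₁])
    refine mem_dolbeaultClosedForms hxs hxt ?_
    change dolbeaultBar (x : MForm 𝓘(ℝ, E) M ℂ (p + q)) = 0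
    rw [hdelbar hxt, ← hd₁, ← hπ₂, hx₂]
    rfl
  · rintro α ⟨hαs, hαt, hαd⟩
    refine ⟨⟨α, (mem_csmoothForms_iff α).2 hαs⟩, ⟨?_, ?_⟩, rfl⟩
    · exact Subtype.ext (by rw [hπ₁]; exact (hio rfl α).1 hαt)
    · refine Subtype.ext ?_
      rw [hπ₂, hd₁]
      change (mextDeriv α).typeComponent p (q + 1) = 0
      rw [← hdelbar hαt, hαd]

/-- Degree-`(p,0)` case of the identification `E_1^{p,0} = H^{p,0}_{∂̄}(M)`: if moreover nothing
of pure type `p` is hit from the lower degree (`π₁ p ∘ d₀ ∘ π₀ p = 0`; there are no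
`∂̄`-exact `(p,0)`-forms), the `∂̄`-cohomology in pure type `p` of the bigraded triple is the
Dolbeault group `H^{p,0}_{∂̄}(M)`. Voisin (2002), Prop. 8.25 with §2.3.3.
[cite: VoisinHodgeI2002, Prop. 8.25] -/
theorem nonempty_pureCohomology_equiv_dolbeaultCohomology_zero {p : ℕ} {A₀ : Type*}
    [AddCommGroup A₀] [Module ℂ A₀]
    (B : BigradedTriple ℂ A₀ ↥(csmoothForms E M p) ↥(csmoothForms E M (p + 1)))
    (hπ₁ : ∀ x, (B.π₁ p x : MForm 𝓘(ℝ, E) M ℂ p) =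
      (x : MForm 𝓘(ℝ, E) M ℂ p).typeComponent p 0)
    (hπ₂ : ∀ y, (B.π₂ p y : MForm 𝓘(ℝ, E) M ℂ (p + 1)) =
      (y : MForm 𝓘(ℝ, E) M ℂ (p + 1)).typeComponent p 1)
    (hd₁ : ∀ x, (B.d₁ x : MForm 𝓘(ℝ, E) M ℂ (p + 1)) = mextDeriv (x : MForm 𝓘(ℝ, E) M ℂ p))
    (h₀ : ∀ y, B.π₁ p (B.d₀ (B.π₀ p y)) = 0)
    (hio : isOfType_iff_typeComponent_eq_self (E := E) (M := M) (k := p))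
    (hdelbar : IsOfType.dolbeaultBar_eq (E := E) (M := M) (k := p)) :
    Nonempty (B.pureCohomology p ≃ₗ[ℂ] dolbeaultCohomology E M p 0) :=
  nonempty_subquotient_equiv (csmoothForms E M p).subtype (B.pureClosed p) (B.pureExact p)
    (dolbeaultClosedForms E M p 0) (dolbeaultExactForms E M p 0)
    (map_pureClosed_eq_dolbeaultClosedForms (p := p) (q := 0) B hπ₁ hπ₂ hd₁ hio hdelbar)
    fun z _ ↦ by
      rw [dolbeaultExactForms_zero, Submodule.mem_bot, B.mem_pureExact]
      constructor
      · intro h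
        exact ⟨0, by rw [map_zero, map_zero, map_zero]; exact (Subtype.ext h).symm⟩
      · rintro ⟨y, rfl⟩
        rw [h₀]
        rfl

/-- Degree-`(p,q+1)` case of the identification `E_1^{p,q+1} = H^{p,q+1}_{∂̄}(M)`: for a bigraded
triple on `A^{p+q} → A^{p+q+1} → A^{p+q+2}` with the type projections of index `p` and `d` in
all three degrees, the `∂̄`-cohomology in pure type `p` is the Dolbeault group `H^{p,q+1}_{∂̄}(M)`
(the `∂̄`-exact `(p,q+1)`-forms `∂̄(A^{p,q})` are the `(dγ^{p,q})^{p,q+1}`, `γ` smooth).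
Voisin (2002), Prop. 8.25 with §2.3.3. [cite: VoisinHodgeI2002, Prop. 8.25] -/
theorem nonempty_pureCohomology_equiv_dolbeaultCohomology_succ [IsManifold 𝓘(ℂ, E) ω M]
    [IsManifold 𝓘(ℝ, E) ∞ M] {p q : ℕ}
    (B : BigradedTriple ℂ ↥(csmoothForms E M (p + q)) ↥(csmoothForms E M (p + q + 1))
      ↥(csmoothForms E M (p + q + 1 + 1)))
    (hπ₀ : ∀ y, (B.π₀ p y : MForm 𝓘(ℝ, E) M ℂ (p + q)) =
      (y : MForm 𝓘(ℝ, E) M ℂ (p + q)).typeComponent p q)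
    (hd₀ : ∀ y, (B.d₀ y : MForm 𝓘(ℝ, E) M ℂ (p + q + 1)) =
      mextDeriv (y : MForm 𝓘(ℝ, E) M ℂ (p + q)))
    (hπ₁ : ∀ x, (B.π₁ p x : MForm 𝓘(ℝ, E) M ℂ (p + q + 1)) =
      (x : MForm 𝓘(ℝ, E) M ℂ (p + q + 1)).typeComponent p (q + 1))
    (hπ₂ : ∀ z, (B.π₂ p z : MForm 𝓘(ℝ, E) M ℂ (p + q + 1 + 1)) =
      (z : MForm 𝓘(ℝ, E) M ℂ (p + q + 1 + 1)).typeComponent p (q + 1 + 1))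
    (hd₁ : ∀ x, (B.d₁ x : MForm 𝓘(ℝ, E) M ℂ (p + q + 1 + 1)) =
      mextDeriv (x : MForm 𝓘(ℝ, E) M ℂ (p + q + 1)))
    (hst : isSmoothForm_typeComponent (E := E) (M := M) (k := p + q))
    (htt : typeComponent_typeComponent (E := E) (M := M) (k := p + q))
    (hio : isOfType_iff_typeComponent_eq_self (E := E) (M := M) (k := p + q))
    (hio' : isOfType_iff_typeComponent_eq_self (E := E) (M := M) (k := p + q + 1))
    (hdelbar : IsOfType.dolbeaultBar_eq (E := E) (M := M) (k := p + q))
    (hdelbar' : IsOfType.dolbeaultBar_eq (E := E) (M := M) (k := p + q + 1)) :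
    Nonempty (B.pureCohomology p ≃ₗ[ℂ] dolbeaultCohomology E M p (q + 1)) := by
  -- the `∂̄`-exact `(p,q+1)`-forms are the image of `pureExact p`
  have hyt : ∀ y : ↥(csmoothForms E M (p + q)),
      IsOfType p q ((y : MForm 𝓘(ℝ, E) M ℂ (p + q)).typeComponent p q) := fun y ↦
    (hio rfl _).2 (by rw [htt, if_pos ⟨rfl, rfl⟩])
  have hex : Submodule.span ℂ (dolbeaultBar ''
      (pqForms E M p q : Set (MForm 𝓘(ℝ, E) M ℂ (p + q)))) =
      (B.pureExact p).map (csmoothForms E M (p + q + 1)).subtype := by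
    refine Submodule.span_eq_of_le _ ?_ ?_
    · rintro _ ⟨w, hw, rfl⟩
      obtain ⟨hws, hwt⟩ := (mem_pqForms_iff w).1 hw
      refine ⟨B.π₁ p (B.d₀ (B.π₀ p ⟨w, (mem_csmoothForms_iff w).2 hws⟩)),
        B.mem_pureExact.2 ⟨_, rfl⟩, ?_⟩
      rw [Submodule.subtype_apply, hπ₁, hd₀, hπ₀]
      change (mextDeriv (w.typeComponent p q)).typeComponent p (q + 1) = dolbeaultBar w
      rw [(hio rfl w).1 hwt, hdelbar hwt]
    · rintro _ ⟨x, hx, rfl⟩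
      obtain ⟨y, rfl⟩ := B.mem_pureExact.1 hx
      refine Submodule.subset_span ⟨(y : MForm 𝓘(ℝ, E) M ℂ (p + q)).typeComponent p q,
        (mem_pqForms_iff _).2 ⟨hst p q ((mem_csmoothForms_iff _).1 y.2), hyt y⟩, ?_⟩
      rw [Submodule.subtype_apply, hπ₁, hd₀, hπ₀, hdelbar (hyt y)]
  refine nonempty_subquotient_equiv (csmoothForms E M (p + q + 1)).subtype (B.pureClosed p)
    (B.pureExact p) (dolbeaultClosedForms E M p (q + 1)) (dolbeaultExactForms E M p (q + 1))
    (map_pureClosed_eq_dolbeaultClosedForms (p := p) (q := q + 1) B hπ₁ hπ₂ hd₁ hio' hdelbar')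
    fun z _ ↦ ?_
  change (z : MForm 𝓘(ℝ, E) M ℂ (p + q + 1)) ∈
      Submodule.span ℂ (dolbeaultBar '' (pqForms E M p q : Set (MForm 𝓘(ℝ, E) M ℂ (p + q)))) ↔ _
  rw [hex, Submodule.mem_map]
  constructor
  · rintro ⟨z', hz', hzz'⟩
    rwa [← Subtype.ext hzz']
  · exact fun hz ↦ ⟨z, hz, rfl⟩

/-! ### Assembly in one degree -/

/-- **Frölicher inequality in degree `k`, from a bigraded triple.** If a bigraded triple on
`A₀ → A^k(M; ℂ) → A^{k+1}(M; ℂ)` has `N = k`, differential `d` out of degree `k`, lower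
differential with image the exact `k`-forms, and `∂̄`-cohomologies in pure type `p ≤ k`
identified with the Dolbeault groups `H^{p,k-p}_{∂̄}(M)`, all finite-dimensional, then
`H^k_dR(M; ℂ)` is finite-dimensional and `dim_ℂ H^k_dR(M; ℂ) ≤ ∑_{p+q=k} h^{p,q}(M)`
(Voisin (2002), §8.3.3, proof of Thm. 8.28 and Rem. 8.29).
[cite: VoisinHodgeI2002, §8.3.3, proof of Thm. 8.28 and Rem. 8.29] -/
theorem finite_and_finrank_complexDeRham_le_of_bigradedTriple {k j : ℕ}
    (B : BigradedTriple ℂ ↥(csmoothForms E M j) ↥(csmoothForms E M k)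
      ↥(csmoothForms E M (k + 1)))
    (hN : B.N = k)
    (hd₁ : ∀ x, (B.d₁ x : MForm 𝓘(ℝ, E) M ℂ (k + 1)) = mextDeriv (x : MForm 𝓘(ℝ, E) M ℂ k))
    (hex : ∀ z : ↥(csmoothForms E M k),
      (z : MForm 𝓘(ℝ, E) M ℂ k) ∈ cexactSmoothForms E M k ↔ z ∈ LinearMap.range B.d₀)
    (hfin : ∀ p ≤ k, FiniteDimensional ℂ (dolbeaultCohomology E M p (k - p)))
    (he : ∀ p ≤ k, Nonempty (B.pureCohomology p ≃ₗ[ℂ] dolbeaultCohomology E M p (k - p))) :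
    FiniteDimensional ℂ (complexDeRhamCohomology E M k) ∧
      finrank ℂ (complexDeRhamCohomology E M k) ≤
        ∑ pq ∈ antidiagonal k, hodgeNumber E M pq.1 pq.2 := by
  obtain ⟨h1, h2⟩ := B.finite_and_finrank_cohomology_le_sum_of_equiv
    (H := fun p ↦ dolbeaultCohomology E M p (k - p))
    (fun p hp ↦ hfin p (hN ▸ hp)) (fun p hp ↦ he p (hN ▸ hp))
  rw [hN] at h2
  have hZ : (LinearMap.ker B.d₁).map (csmoothForms E M k).subtype = cclosedSmoothForms E M k := by
    refine le_antisymm ?_ (Submodule.span_le.2 ?_)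
    · rintro _ ⟨z, hz, rfl⟩
      refine mem_cclosedSmoothForms ((mem_csmoothForms_iff _).1 z.2) ?_
      change mextDeriv (z : MForm 𝓘(ℝ, E) M ℂ k) = 0
      rw [← hd₁, LinearMap.mem_ker.1 hz]
      rfl
    · rintro α ⟨hαs, hαc⟩
      exact ⟨⟨α, (mem_csmoothForms_iff α).2 hαs⟩,
        LinearMap.mem_ker.2 (Subtype.ext (by rw [hd₁]; exact hαc)), rfl⟩
  obtain ⟨e⟩ := nonempty_subquotient_equiv (csmoothForms E M k).subtype
    (LinearMap.ker B.d₁) (LinearMap.range B.d₀) (cclosedSmoothForms E M k)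
    (cexactSmoothForms E M k) hZ (fun z _ ↦ hex z)
  haveI : FiniteDimensional ℂ B.cohomology := h1
  have e' : B.cohomology ≃ₗ[ℂ] complexDeRhamCohomology E M k := e
  refine ⟨LinearEquiv.finiteDimensional e', ?_⟩
  calc finrank ℂ (complexDeRhamCohomology E M k)
      = finrank ℂ B.cohomology := (LinearEquiv.finrank_eq e').symm
    _ ≤ ∑ p ∈ range (k + 1), finrank ℂ (dolbeaultCohomology E M p (k - p)) := h2
    _ = ∑ pq ∈ antidiagonal k, hodgeNumber E M pq.1 pq.2 :=
        (Finset.Nat.sum_antidiagonal_eq_sum_range_succ (fun p q ↦ hodgeNumber E M p q) k).symm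

end FrolicherLemmas

end Literature.AlgebraicGeometry.Motives
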